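import Summits.ABC.IUTFork.Repair.RHHullThresholdExact
import Summits.ABC.IUTFork.Conditional.WRowHexLamSevenTriplesTwentyThree
import HarnessLib

/-!
# R-W WINDOW numerics, HEX family `λ_k = 1/2 + 2/7^k` at `k = 23`: the REFUTED BAND's INTEGER CELLS, first half (part (R-cells-A): the floor-free piece lemmas of the first member / lower pieces; the class lemma is in `…RefutedCells.lean`, the W-lane shapes in `…RefutedBand.lean`) —
# top-label `HullCell` failures over the sharp class for `(ratPoint λ_23, l)` for EVERY prime `481 ≤ l ≤ 98866283`, e-robustly and UNIFORMLY in `l`; glue: every prime `11 ≤ l ≤ 98866283`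

PROOF-ONLY file (D-0012; 0 definitions, 0 `Prop` facts, no instance, no notation) of the abc-iut cell (branch C certificate seat
abc-iut-C-cert-1, gen 9; row «W:HEX-AXIS-REST-2», `k = 23`, part (R); generator gen_ref.py (HOME/staging/C/cert-1/g9/hexgen/, analytic piece plan) from the `k = 10` template p508090 and gen 8's `k = 12…17` files).
TAKES NO SIDE on [IUTchIII] Cor. 3.12 (S. Mochizuki, *Inter-universal Teichmüller theory III*, Cor. 3.12 p. 173–174; Step (xi-f) p. 184) or on any
author; «refuted as typed» ≠ «refuted in print». BEFORE THIS FILE (BY NAME): at `k = 23` the K-line object FAILS at every prime `11 ≤ l ≤ 479` (abc-iut-W-neg-2's `HexRad.not_pilotKummerCompatHull_lamSeven_rad_eleven`, every `k ≥ 11`); no theorem names a level `l ≥ 481`.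
THIS FILE: at the pole `p = 7` of the HEX23 triple `27368747340080916347 + 27368747340080916339 = 54737494680161832686` (`v = v₇(abc) = 23`; prelude `WRowHexLamSevenTriplesTwentyThree`) abc-iut-W-neg-1's SHARP local-type
class (`WRow.localType_class_triple_sharp`, p498814 §1) leaves `A ∈ {15, 30}`; per member and turning-point piece
(A = 15: a₀ = 4 on 481 ≤ l ≤ 959; A = 15: a₀ = 5 on 961 ≤ l ≤ 6721; A = 15: a₀ = 6 on 6723 ≤ l ≤ 47059; A = 15: a₀ = 7 on 47061 ≤ l ≤ 329417; A = 15: a₀ = 8 on 329419 ≤ l ≤ 2305919; A = 15: a₀ = 9 on 2305921 ≤ l ≤ 16141441; A = 15: a₀ = 10 on 16141443 ≤ l ≤ 98866285; A = 30: a₀ = 5 on 481 ≤ l ≤ 3361; A = 30: a₀ = 6 on 3363 ≤ l ≤ 23529; A = 30: a₀ = 7 on 23531 ≤ l ≤ 164707; A = 30: a₀ = 8 on 164709 ≤ l ≤ 1152959; A = 30: a₀ = 9 on 1152961 ≤ l ≤ 8070721; A = 30: a₀ = 10 on 8070723 ≤ l ≤ 56495049; A = 30: a₀ = 11 on 56495051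 ≤ l ≤ 98866285) the top-label cell of R-H row 4's `HullCell` FAILS by a
floor-free downward parabola (`e·⌊X/e⌋ ≥ X − e + 1`, inner radius bounded by `6·r_in ≤ A·l + 6`), with no exact-floor literal level (the floor-free pieces reach the last refuted prime).
W-neg-1's three sockets (`Cor312LicenceTripleHullCellRefuteTameSharp` §2), transported to `ratPoint ((2 : ℚ)⁻¹ + 2/7^k)`, `k = 23`, give the three W-lane shapes
`WRow.not_licence_lamSeven_twentyThree_band` / `WRow.not_exists_qPinned_and_hull_lamSeven_twentyThree_band` / `GenuineK.not_pilotKummerCompatHull_chosen_lamSeven_twentyThree_band`,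
and the GLUE `GenuineK.not_pilotKummerCompatHull_chosen_lamSeven_twentyThree_le` (every prime `11 ≤ l ≤ 98866283`). DESK (two engines agree: this seat's analytic piece plan (gen 8's scan semantics)
and abc-iut-W-num-5 g5's engine C, STATUS 07:20:50Z): the exact top-label cell fails at every prime of the band and first holds at `l = 98866289`; the
inhabited band from there is part (I) (`WRow.licence_lamSeven_twentyThree_all`), NOT claimed here. These levels are NOT rows of the R-W WINDOW-TABLE.
HONEST SCOPE: OUR sharp containers and Dupuy–Hilado's typed (Ind1)/(Ind2); the per-label licence is a STRONGER-THAN-PRINT sufficient form of Step (xi-f);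
admissibility / Szpiro-badness / (P6) of `(ratPoint λ_23, l)` and NON-EMPTINESS of the datum type are NOT claimed (a «∀ T» statement is vacuous if no datum
exists); nothing about the printed inequality, the number-level `Cor22.Cor312AtDatum` or any author's intended hull; typed ≠ proved; instantiated ≠ endorsed; no abc claim.
[cite: Mochizuki2012, IUTchI Ex. 3.2 (iv) p. 71; IUTchIII Cor. 3.12 Step (xi-d) p. 183, (xi-f) p. 184; IUTchIV Prop. 1.1 p. 9, Prop. 1.2 (i)(ii) p. 10, Thm. 1.10 p. 22, Cor. 2.2 (ii) proof (P5) p. 46]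
[cite: DupuyHilado2025, §3.3, §3.4, §4.9, §4.12] [cite: SilvermanATAEC1994, V.5 Thm. 5.3 and Cor. 5.4] [claim: Mochizuki2012, status: disputed] for every IUT sentence quoted.
-/

noncomputable section

open Set Function NumberField IsDedekindDomain

namespace Summit.ABC.IUTFork.Conditional

open Thm311 Thm311.Real Cor312 Cor312Vol Cor312Prov Literature.IUT.LogThetaLattice Literature.IUT.LogVolume
  Literature.IUT.HodgeTheaters Literature.IUT.LogVolume.ThetaData Literature.IUT.LogVolume.Cor22
open Literature.NumberTheory.NumberFields Literature.NumberTheory.GaloisRepresentations.Ultrametric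
open Literature.NumberTheory.DiophantineGeometry Literature.NumberTheory.DiophantineGeometry.GenEll Summit.ABC.ABC.Theorems
open Summit.ABC.IUTFork.Repair.RH.HullThresholdExact

/-! ## §1. The integer side at `p = 7`, `v = 23`: class `A ∈ {15, 30}`, top label -/

/-- Floor-free failure of the top-label cell, `k = 23`, member `A = 15` (`e = 15l`, `m = 345`), turning point `a₀ = 4` (`r_out = 2401 − 4·15l`),
every `240 ≤ j ≤ 479` (`l = 2j + 1`), for ANY inner radius with `6·r_in ≤ 15l + 6` (so for `⌊15l/6⌋ + 1`): `e·⌊X/e⌋ ≥ X − e + 1` and the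
margin is a downward parabola in `j` positive on the range. [folklore] -/
theorem RefBand.not_hullCell_hex23_A15_a4 {j rin : ℤ} (hlo : 240 ≤ j) (hhi : j ≤ 479) (hrin : 6 * rin ≤ 15 * (2 * j + 1) + 6) :
    ¬ HullCell (15 * (2 * j + 1)) 345 j rin (2401 - 4 * (15 * (2 * j + 1))) := by
  intro hc
  unfold HullCell at hc
  set e : ℤ := 15 * (2 * j + 1) with he
  have he0 : 0 < e := by rw [he]; omega
  set X : ℤ := j ^ 2 * 345 - j * (e - 1) - (j + 1) * rin with hX
  have hdiv : X - e < e * (X / e) := by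
    have h1 := Int.emod_add_mul_ediv X e
    have h2 := Int.emod_lt_of_pos X he0
    have h3 := Int.emod_nonneg X he0.ne'
    nlinarith [h1, h2, h3]
  have hk1 : 0 ≤ (479 - j) * (j + 1) := mul_nonneg (by omega) (by omega)
  have hk2 : 0 ≤ (479 - j) * (j - 240) := mul_nonneg (by omega) (by omega)
  nlinarith [hdiv, hk1, hk2, hc, hrin, hX]

/-- Floor-free failure of the top-label cell, `k = 23`, member `A = 15` (`e = 15l`, `m = 345`), turning point `a₀ = 5` (`r_out = 16807 − 5·15l`),
every `480 ≤ j ≤ 3360` (`l = 2j + 1`), for ANY inner radius with `6·r_in ≤ 15l + 6` (so for `⌊15l/6⌋ + 1`): `e·⌊X/e⌋ ≥ X − e + 1` and the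
margin is a downward parabola in `j` positive on the range. [folklore] -/
theorem RefBand.not_hullCell_hex23_A15_a5 {j rin : ℤ} (hlo : 480 ≤ j) (hhi : j ≤ 3360) (hrin : 6 * rin ≤ 15 * (2 * j + 1) + 6) :
    ¬ HullCell (15 * (2 * j + 1)) 345 j rin (16807 - 5 * (15 * (2 * j + 1))) := by
  intro hc
  unfold HullCell at hc
  set e : ℤ := 15 * (2 * j + 1) with he
  have he0 : 0 < e := by rw [he]; omega
  set X : ℤ := j ^ 2 * 345 - j * (e - 1) - (j + 1) * rin with hX
  have hdiv : X - e < e * (X / e) := by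
    have h1 := Int.emod_add_mul_ediv X e
    have h2 := Int.emod_lt_of_pos X he0
    have h3 := Int.emod_nonneg X he0.ne'
    nlinarith [h1, h2, h3]
  have hk1 : 0 ≤ (3360 - j) * (j + 1) := mul_nonneg (by omega) (by omega)
  have hk2 : 0 ≤ (3360 - j) * (j - 480) := mul_nonneg (by omega) (by omega)
  nlinarith [hdiv, hk1, hk2, hc, hrin, hX]

/-- Floor-free failure of the top-label cell, `k = 23`, member `A = 15` (`e = 15l`, `m = 345`), turning point `a₀ = 6` (`r_out = 117649 − 6·15l`),
every `3361 ≤ j ≤ 23529` (`l = 2j + 1`), for ANY inner radius with `6·r_in ≤ 15l + 6` (so for `⌊15l/6⌋ + 1`): `e·⌊X/e⌋ ≥ X − e + 1` and the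
margin is a downward parabola in `j` positive on the range. [folklore] -/
theorem RefBand.not_hullCell_hex23_A15_a6 {j rin : ℤ} (hlo : 3361 ≤ j) (hhi : j ≤ 23529) (hrin : 6 * rin ≤ 15 * (2 * j + 1) + 6) :
    ¬ HullCell (15 * (2 * j + 1)) 345 j rin (117649 - 6 * (15 * (2 * j + 1))) := by
  intro hc
  unfold HullCell at hc
  set e : ℤ := 15 * (2 * j + 1) with he
  have he0 : 0 < e := by rw [he]; omega
  set X : ℤ := j ^ 2 * 345 - j * (e - 1) - (j + 1) * rin with hX
  have hdiv : X - e < e * (X / e) := by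
    have h1 := Int.emod_add_mul_ediv X e
    have h2 := Int.emod_lt_of_pos X he0
    have h3 := Int.emod_nonneg X he0.ne'
    nlinarith [h1, h2, h3]
  have hk1 : 0 ≤ (23529 - j) * (j + 1) := mul_nonneg (by omega) (by omega)
  have hk2 : 0 ≤ (23529 - j) * (j - 3361) := mul_nonneg (by omega) (by omega)
  nlinarith [hdiv, hk1, hk2, hc, hrin, hX]

/-- Floor-free failure of the top-label cell, `k = 23`, member `A = 15` (`e = 15l`, `m = 345`), turning point `a₀ = 7` (`r_out = 823543 − 7·15l`),
every `23530 ≤ j ≤ 164708` (`l = 2j + 1`), for ANY inner radius with `6·r_in ≤ 15l + 6` (so for `⌊15l/6⌋ + 1`): `e·⌊X/e⌋ ≥ X − e + 1` and the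
margin is a downward parabola in `j` positive on the range. [folklore] -/
theorem RefBand.not_hullCell_hex23_A15_a7 {j rin : ℤ} (hlo : 23530 ≤ j) (hhi : j ≤ 164708) (hrin : 6 * rin ≤ 15 * (2 * j + 1) + 6) :
    ¬ HullCell (15 * (2 * j + 1)) 345 j rin (823543 - 7 * (15 * (2 * j + 1))) := by
  intro hc
  unfold HullCell at hc
  set e : ℤ := 15 * (2 * j + 1) with he
  have he0 : 0 < e := by rw [he]; omega
  set X : ℤ := j ^ 2 * 345 - j * (e - 1) - (j + 1) * rin with hX
  have hdiv : X - e < e * (X / e) := by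
    have h1 := Int.emod_add_mul_ediv X e
    have h2 := Int.emod_lt_of_pos X he0
    have h3 := Int.emod_nonneg X he0.ne'
    nlinarith [h1, h2, h3]
  have hk1 : 0 ≤ (164708 - j) * (j + 1) := mul_nonneg (by omega) (by omega)
  have hk2 : 0 ≤ (164708 - j) * (j - 23530) := mul_nonneg (by omega) (by omega)
  nlinarith [hdiv, hk1, hk2, hc, hrin, hX]

/-- Floor-free failure of the top-label cell, `k = 23`, member `A = 15` (`e = 15l`, `m = 345`), turning point `a₀ = 8` (`r_out = 5764801 − 8·15l`),
every `164709 ≤ j ≤ 1152959` (`l = 2j + 1`), for ANY inner radius with `6·r_in ≤ 15l + 6` (so for `⌊15l/6⌋ + 1`): `e·⌊X/e⌋ ≥ X − e + 1` and the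
margin is a downward parabola in `j` positive on the range. [folklore] -/
theorem RefBand.not_hullCell_hex23_A15_a8 {j rin : ℤ} (hlo : 164709 ≤ j) (hhi : j ≤ 1152959) (hrin : 6 * rin ≤ 15 * (2 * j + 1) + 6) :
    ¬ HullCell (15 * (2 * j + 1)) 345 j rin (5764801 - 8 * (15 * (2 * j + 1))) := by
  intro hc
  unfold HullCell at hc
  set e : ℤ := 15 * (2 * j + 1) with he
  have he0 : 0 < e := by rw [he]; omega
  set X : ℤ := j ^ 2 * 345 - j * (e - 1) - (j + 1) * rin with hX
  have hdiv : X - e < e * (X / e) := by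
    have h1 := Int.emod_add_mul_ediv X e
    have h2 := Int.emod_lt_of_pos X he0
    have h3 := Int.emod_nonneg X he0.ne'
    nlinarith [h1, h2, h3]
  have hk1 : 0 ≤ (1152959 - j) * (j + 1) := mul_nonneg (by omega) (by omega)
  have hk2 : 0 ≤ (1152959 - j) * (j - 164709) := mul_nonneg (by omega) (by omega)
  nlinarith [hdiv, hk1, hk2, hc, hrin, hX]

/-- Floor-free failure of the top-label cell, `k = 23`, member `A = 15` (`e = 15l`, `m = 345`), turning point `a₀ = 9` (`r_out = 40353607 − 9·15l`),
every `1152960 ≤ j ≤ 8070720` (`l = 2j + 1`), for ANY inner radius with `6·r_in ≤ 15l + 6` (so for `⌊15l/6⌋ + 1`): `e·⌊X/e⌋ ≥ X − e + 1` and the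
margin is a downward parabola in `j` positive on the range. [folklore] -/
theorem RefBand.not_hullCell_hex23_A15_a9 {j rin : ℤ} (hlo : 1152960 ≤ j) (hhi : j ≤ 8070720) (hrin : 6 * rin ≤ 15 * (2 * j + 1) + 6) :
    ¬ HullCell (15 * (2 * j + 1)) 345 j rin (40353607 - 9 * (15 * (2 * j + 1))) := by
  intro hc
  unfold HullCell at hc
  set e : ℤ := 15 * (2 * j + 1) with he
  have he0 : 0 < e := by rw [he]; omega
  set X : ℤ := j ^ 2 * 345 - j * (e - 1) - (j + 1) * rin with hX
  have hdiv : X - e < e * (X / e) := by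
    have h1 := Int.emod_add_mul_ediv X e
    have h2 := Int.emod_lt_of_pos X he0
    have h3 := Int.emod_nonneg X he0.ne'
    nlinarith [h1, h2, h3]
  have hk1 : 0 ≤ (8070720 - j) * (j + 1) := mul_nonneg (by omega) (by omega)
  have hk2 : 0 ≤ (8070720 - j) * (j - 1152960) := mul_nonneg (by omega) (by omega)
  nlinarith [hdiv, hk1, hk2, hc, hrin, hX]

/-- Floor-free failure of the top-label cell, `k = 23`, member `A = 15` (`e = 15l`, `m = 345`), turning point `a₀ = 10` (`r_out = 282475249 − 10·15l`),
every `8070721 ≤ j ≤ 49433142` (`l = 2j + 1`), for ANY inner radius with `6·r_in ≤ 15l + 6` (so for `⌊15l/6⌋ + 1`): `e·⌊X/e⌋ ≥ X − e + 1` and the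
margin is a downward parabola in `j` positive on the range. [folklore] -/
theorem RefBand.not_hullCell_hex23_A15_a10 {j rin : ℤ} (hlo : 8070721 ≤ j) (hhi : j ≤ 49433142) (hrin : 6 * rin ≤ 15 * (2 * j + 1) + 6) :
    ¬ HullCell (15 * (2 * j + 1)) 345 j rin (282475249 - 10 * (15 * (2 * j + 1))) := by
  intro hc
  unfold HullCell at hc
  set e : ℤ := 15 * (2 * j + 1) with he
  have he0 : 0 < e := by rw [he]; omega
  set X : ℤ := j ^ 2 * 345 - j * (e - 1) - (j + 1) * rin with hX
  have hdiv : X - e < e * (X / e) := by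
    have h1 := Int.emod_add_mul_ediv X e
    have h2 := Int.emod_lt_of_pos X he0
    have h3 := Int.emod_nonneg X he0.ne'
    nlinarith [h1, h2, h3]
  have hk1 : 0 ≤ (49433142 - j) * (j + 1) := mul_nonneg (by omega) (by omega)
  have hk2 : 0 ≤ (49433142 - j) * (j - 8070721) := mul_nonneg (by omega) (by omega)
  nlinarith [hdiv, hk1, hk2, hc, hrin, hX]

end Summit.ABC.IUTFork.Conditional

end
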